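import Literature.Geometry.Lorentzian.SpacetimePointPush
import Literature.Geometry.Lorentzian.BilinPullbackPointPush
import Literature.Geometry.Lorentzian.SpacetimeChartBridge
import HarnessLib

/-!
# The point pushes of a spacetime converge to the identity in `Cᵏ_loc` and preserve the time
# orientation for small push vectors
(topic `Geometry/Lorentzian`; the two analytic clauses of the point-pushing convergence datum,
`SpacetimePointPushDatum.lean`; Petersen 2006, Ch. 10, §3.2; O'Neill 1983, Ch. 5, p. 145)

For a push datum `P : PushData 𝓢 x₀` (chart `c = chartAt E4 x₀`) and its pushes `P.push v`:

* `eventually_isFutureDirected_mfderiv_push` — for all small `v`, the differential of `P.push v`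
  sends the orienting field of `𝓢` at EVERY point to a future-directed vector (off the support set
  the push is the identity; on the compact support set `⊆ c.source` the two scalars
  `g(dψ T, dψ T)` and `g(T, dψ T)` are continuous functions of `(q, v)` which are negative at `v = 0`).
* `tendsto_supCkENorm_metricInCoords_push_sub` — for every point `x` and compact `K` in the target
  of `chartAt E4 x`, `supCkENorm K k ((P.push v ∘ c_x⁻¹)^* g − (c_x⁻¹)^* g) → 0` as `v → 0`
  (off the support set the difference vanishes; over `c.source` it is the transport along the chart
  transition of `θ_v^* G_c − G_c`, `G_c = (c⁻¹)^* g`, which tends to `0` by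
  `tendsto_supCkENorm_bilinPullback_pointPush_sub`).

## References
* [Petersen2006] P. Petersen, *Riemannian Geometry*, 2nd ed., GTM 171, Springer 2006, Ch. 10, §3.2.
* [ONeill1983] B. O'Neill, *Semi-Riemannian Geometry*, Academic Press 1983, Ch. 5, p. 145.
-/

noncomputable section

open TopologicalSpace Manifold Filter Topology Set Function Metric
open scoped ContDiff Topology ENNReal NNReal
open Literature.Analysis.Calculus

universe u

namespace Literature.Geometry.Lorentzian

/-! ### Functoriality of the coordinate pullback -/

section Functoriality

variable {E F G : Type*} [NormedAddCommGroup E] [NormedSpace ℝ E] [NormedAddCommGroup F]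
  [NormedSpace ℝ F] [NormedAddCommGroup G] [NormedSpace ℝ G]

/-- **Functoriality**: `bilinPullback (θ ∘ τ) B y = bilinPullback τ (bilinPullback θ B) y` for `τ`
differentiable at `y` and `θ` at `τ y` (chain rule). [folklore] -/
theorem bilinPullback_comp_apply {θ : F → G} {τ : E → F} {y : E} (hθ : DifferentiableAt ℝ θ (τ y))
    (hτ : DifferentiableAt ℝ τ y) (B : G → G →L[ℝ] G →L[ℝ] ℝ) :
    bilinPullback (θ ∘ τ) B y = bilinPullback τ (bilinPullback θ B) y := by
  ext v w
  simp only [bilinPullback_apply, comp_apply, fderiv_comp y hθ hτ, ContinuousLinearMap.coe_comp]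

/-- The coordinate pullback at `y` only sees the value of the field at `τ y`. [folklore] -/
theorem bilinPullback_congr_point {τ : E → F} {y : E} {B₁ B₂ : F → F →L[ℝ] F →L[ℝ] ℝ}
    (h : B₁ (τ y) = B₂ (τ y)) : bilinPullback τ B₁ y = bilinPullback τ B₂ y := by
  ext v w
  simp only [bilinPullback_apply, h]

end Functoriality

namespace Spacetime

namespace PushData

variable {𝓢 : Spacetime.{u} 4} {x₀ : 𝓢.carrier} (P : PushData 𝓢 x₀)

/-! ### The differential of a push in the chart at `x₀` -/

/-- The coordinate image `d(c)_q u ∈ E4` of a tangent vector in the chart at `x₀` (typed in `E4`).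
[folklore] -/
def coord (_P : PushData 𝓢 x₀) (q : 𝓢.carrier) (u : TangentSpace (𝓡 4) q) : E4 :=
  mfderiv (𝓡 4) 𝓘(ℝ, E4) (chartAt E4 x₀) q u

/-- Unfolding `coord`. [folklore] -/
theorem coord_eq (q : 𝓢.carrier) (u : TangentSpace (𝓡 4) q) :
    P.coord q u = mfderiv (𝓡 4) 𝓘(ℝ, E4) (chartAt E4 x₀) q u := rfl

/-- The differential of the Euclidean push: `mfderiv (θ_v) y = id + Dχ(y) ⊗ v`. [folklore] -/
theorem mfderiv_θ (v y : E4) :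
    mfderiv 𝓘(ℝ, E4) 𝓘(ℝ, E4) (P.θ v) y =
      ContinuousLinearMap.id ℝ E4 + (fderiv ℝ (P.χ : E4 → ℝ) y).smulRight v := by
  rw [mfderiv_eq_fderiv]
  exact fderiv_pointPush ((P.χ.contDiff (n := 1)).differentiable one_ne_zero y) v

/-- **The differential of the push on a vector, in the chart at `x₀`**: for `q ∈ c.source` and
`‖v‖ < R`, `d(P.push v)_q u = d(c⁻¹)_{θ_v (c q)} (d(c)_q u + (Dχ(c q) (d(c)_q u)) • v)`. [folklore] -/
theorem mfderiv_push_apply {v : E4} (hv : ‖v‖ < P.R) {q : 𝓢.carrier}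
    (hq : q ∈ (chartAt E4 x₀).source) (u : TangentSpace (𝓡 4) q) :
    (mfderiv (𝓡 4) (𝓡 4) (P.push v) q u : E4) =
      mfderiv 𝓘(ℝ, E4) (𝓡 4) (chartAt E4 x₀).symm (P.θ v (chartAt E4 x₀ q))
        (P.coord q u + (fderiv ℝ (P.χ : E4 → ℝ) (chartAt E4 x₀ q) (P.coord q u)) • v) := by
  set c := chartAt E4 x₀ with hc
  have hcq : MDifferentiableAt (𝓡 4) 𝓘(ℝ, E4) c q := (mdifferentiable_chart x₀).mdifferentiableAt hq
  have hθd : MDifferentiableAt 𝓘(ℝ, E4) 𝓘(ℝ, E4) (P.θ v) (c q) :=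
    ((P.contDiff_θ v).contMDiff.contMDiffAt).mdifferentiableAt (by simp)
  have hsymm : MDifferentiableAt 𝓘(ℝ, E4) (𝓡 4) c.symm (P.θ v (c q)) :=
    mdifferentiableAt_atlas_symm (chart_mem_atlas E4 x₀) (P.θ_mem_target hv (c.map_source hq))
  rw [(P.push_eventuallyEq_comp (v := v) hq).mfderiv_eq]
  rw [show (c.symm ∘ P.θ v ∘ c) = c.symm ∘ (P.θ v ∘ c) from rfl,
    mfderiv_comp q hsymm (hθd.comp q hcq), mfderiv_comp q hθd hcq, P.mfderiv_θ]
  rfl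

/-! ### Time orientation for small pushes -/

/-- **Small pushes preserve the time orientation everywhere.** For all small `v`, the differential
of `P.push v` sends the orienting field at every point to a future-directed vector
(O'Neill 1983, Ch. 5, p. 145: timecones are open). [cite: ONeill1983, Ch. 5, p. 145] -/
theorem eventually_isFutureDirected_mfderiv_push :
    ∀ᶠ v in 𝓝 (0 : E4), ∀ q : 𝓢.carrier, 𝓢.timeOrientation.IsFutureDirected
      (mfderiv (𝓡 4) (𝓡 4) (P.push v) q (𝓢.timeOrientation.vectorField q)) := by
  set c := chartAt E4 x₀ with hc
  -- coordinate quantities as functions of `(q, v)`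
  let Tc : 𝓢.carrier → E4 := fun q ↦ P.coord q (𝓢.timeOrientation.vectorField q)
  let z : 𝓢.carrier × E4 → E4 := fun p ↦ P.θ p.2 (c p.1)
  let W : 𝓢.carrier × E4 → E4 := fun p ↦ Tc p.1 + (fderiv ℝ (P.χ : E4 → ℝ) (c p.1) (Tc p.1)) • p.2
  let m : E4 → E4 →L[ℝ] E4 →L[ℝ] ℝ := 𝓢.metricInCoords c.symm
  let α : 𝓢.carrier × E4 → ℝ := fun p ↦ m (z p) (W p) (W p)
  let β : 𝓢.carrier × E4 → ℝ := fun p ↦ m (z p) (Tc (c.symm (z p))) (W p)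
  -- the open set `A = c.source × ball 0 R` and continuity there
  set A : Set (𝓢.carrier × E4) := (c.source : Set 𝓢.carrier) ×ˢ ball (0 : E4) P.R with hA
  have hAo : IsOpen A := c.open_source.prod isOpen_ball
  have hTc : ContinuousOn Tc c.source :=
    (𝓢.timeOrientation.contMDiffOn_chartTime (by exact_mod_cast le_top) x₀).continuousOn.congr
      fun q hq ↦ (𝓢.chartTime_eq_mfderiv hq).symm
  have hzA : ∀ p ∈ A, z p ∈ c.target := fun p hp ↦
    P.θ_mem_target (by simpa using hp.2) (c.map_source hp.1)
  have hzc : ContinuousOn z A := by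
    have h1 : Continuous fun p : E4 × E4 ↦ pointPush P.χ p.2 p.1 :=
      continuous_fst.add ((P.χ.continuous.comp continuous_fst).smul continuous_snd)
    have h2 : ContinuousOn (fun p : 𝓢.carrier × E4 ↦ (c p.1, p.2)) A :=
      ((c.continuousOn.comp continuousOn_fst fun p hp ↦ hp.1).prodMk continuousOn_snd)
    exact h1.comp_continuousOn h2
  have hTc1 : ContinuousOn (fun p : 𝓢.carrier × E4 ↦ Tc p.1) A :=
    hTc.comp continuousOn_fst fun p hp ↦ hp.1
  have hWc : ContinuousOn W A := by
    have hχ' : Continuous (fderiv ℝ (P.χ : E4 → ℝ)) :=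
      (P.χ.contDiff (n := 1)).continuous_fderiv one_ne_zero
    have h1 : ContinuousOn (fun p : 𝓢.carrier × E4 ↦ fderiv ℝ (P.χ : E4 → ℝ) (c p.1)) A :=
      hχ'.comp_continuousOn (c.continuousOn.comp continuousOn_fst fun p hp ↦ hp.1)
    exact hTc1.add ((h1.clm_apply hTc1).smul continuousOn_snd)
  have hmc : ContinuousOn (fun p : 𝓢.carrier × E4 ↦ m (z p)) A :=
    (𝓢.contDiffOn_metricInCoords_chartAt_symm x₀).continuousOn.comp hzc hzA
  have hTz : ContinuousOn (fun p : 𝓢.carrier × E4 ↦ Tc (c.symm (z p))) A :=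
    hTc.comp (c.continuousOn_symm.comp hzc hzA) fun p hp ↦ c.map_target (hzA p hp)
  have hαc : ContinuousOn α A := (hmc.clm_apply hWc).clm_apply hWc
  have hβc : ContinuousOn β A := (hmc.clm_apply hTz).clm_apply hWc
  -- at `v = 0` both scalars are `g(T, T) < 0`
  have hW0 : ∀ q, W (q, 0) = Tc q := fun q ↦ by simp [W]
  have hz0 : ∀ q, z (q, 0) = c q := fun q ↦ by simp [z, PushData.θ]
  have hα0 : ∀ q ∈ c.source, α (q, 0) < 0 := by
    intro q hq
    show m (z (q, 0)) (W (q, 0)) (W (q, 0)) < 0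
    rw [hW0, hz0]
    show 𝓢.metricInCoords c.symm (c q)
      (mfderiv (𝓡 4) 𝓘(ℝ, E4) c q (𝓢.timeOrientation.vectorField q))
      (mfderiv (𝓡 4) 𝓘(ℝ, E4) c q (𝓢.timeOrientation.vectorField q)) < 0
    rw [𝓢.metricInCoords_chartAt_symm_apply_mfderiv hq]
    exact 𝓢.timeOrientation.isTimelike q
  have hβ0 : ∀ q ∈ c.source, β (q, 0) < 0 := by
    intro q hq
    show m (z (q, 0)) (Tc (c.symm (z (q, 0)))) (W (q, 0)) < 0
    rw [hW0, hz0, c.left_inv hq]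
    show 𝓢.metricInCoords c.symm (c q)
      (mfderiv (𝓡 4) 𝓘(ℝ, E4) c q (𝓢.timeOrientation.vectorField q))
      (mfderiv (𝓡 4) 𝓘(ℝ, E4) c q (𝓢.timeOrientation.vectorField q)) < 0
    rw [𝓢.metricInCoords_chartAt_symm_apply_mfderiv hq]
    exact 𝓢.timeOrientation.isTimelike q
  -- the good set and a tube around `supportSet × {0}`
  set N : Set (𝓢.carrier × E4) := {p | p ∈ A ∧ α p < 0 ∧ β p < 0} with hN
  have hNo : IsOpen N := by
    have h1 : IsOpen (A ∩ α ⁻¹' Iio 0) := hαc.isOpen_inter_preimage hAo isOpen_Iio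
    have h2 : IsOpen (A ∩ β ⁻¹' Iio 0) := hβc.isOpen_inter_preimage hAo isOpen_Iio
    have : N = (A ∩ α ⁻¹' Iio 0) ∩ (A ∩ β ⁻¹' Iio 0) := by
      ext p; simp only [hN, mem_setOf_eq, mem_inter_iff, mem_preimage, mem_Iio]; tauto
    rw [this]; exact h1.inter h2
  have hS0 : P.supportSet ×ˢ ({0} : Set E4) ⊆ N := by
    rintro ⟨q, v⟩ ⟨hq, hv⟩
    rw [mem_singleton_iff] at hv; subst hv
    have hqs := P.supportSet_subset_source hq
    exact ⟨⟨hqs, by simp [P.R_pos]⟩, hα0 q hqs, hβ0 q hqs⟩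
  obtain ⟨U, V, -, hV, hSU, h0V, hUV⟩ :=
    generalized_tube_lemma P.isCompact_supportSet isCompact_singleton hNo hS0
  have hVn : V ∈ 𝓝 (0 : E4) := hV.mem_nhds (h0V rfl)
  have hR : ∀ᶠ v in 𝓝 (0 : E4), ‖v‖ < P.R := by
    filter_upwards [Metric.ball_mem_nhds (0 : E4) P.R_pos] with v hv; simpa using hv
  filter_upwards [hVn, hR] with v hv hvR q
  by_cases hq : q ∈ P.supportSet
  · -- on the support set: the two scalars are negative
    have hqs : q ∈ c.source := P.supportSet_subset_source hq
    obtain ⟨-, hα, hβ⟩ := hUV (⟨hSU hq, hv⟩ : (q, v) ∈ U ×ˢ V)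
    set zz := z (q, v) with hzz
    have hzzt : zz ∈ c.target := P.θ_mem_target hvR (c.map_source hqs)
    have hzzs : c.symm zz ∈ c.source := c.map_target hzzt
    -- the pushed vector and the pushed point
    have hpt : P.push v q = c.symm zz := P.push_apply_of_mem hqs
    have hvec : (mfderiv (𝓡 4) (𝓡 4) (P.push v) q (𝓢.timeOrientation.vectorField q) : E4) =
        mfderiv 𝓘(ℝ, E4) (𝓡 4) c.symm zz (W (q, v)) := P.mfderiv_push_apply hvR hqs _
    rw [LorentzianMetric.isFutureDirected_congr_point hpt hvec]
    have htl : 𝓢.metric.IsTimelike (mfderiv 𝓘(ℝ, E4) (𝓡 4) c.symm zz (W (q, v))) := hα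
    refine ⟨htl.isCausal, ?_⟩
    · -- `T (c⁻¹ zz) = d(c⁻¹)_zz (Tc (c⁻¹ zz))`
      have hT : (𝓢.timeOrientation.vectorField (c.symm zz) : E4) =
          mfderiv 𝓘(ℝ, E4) (𝓡 4) c.symm zz (Tc (c.symm zz)) := by
        have h := 𝓢.mfderiv_chartAt_symm_mfderiv_chartAt hzzs (𝓢.timeOrientation.vectorField _)
        rw [c.right_inv hzzt] at h
        exact h.symm
      show 𝓢.metric.val (c.symm zz) (𝓢.timeOrientation.vectorField (c.symm zz))
        (mfderiv 𝓘(ℝ, E4) (𝓡 4) c.symm zz (W (q, v))) < 0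
      have e : 𝓢.metric.val (c.symm zz) (𝓢.timeOrientation.vectorField (c.symm zz))
          (mfderiv 𝓘(ℝ, E4) (𝓡 4) c.symm zz (W (q, v))) = β (q, v) := by
        show _ = 𝓢.metricInCoords c.symm zz (Tc (c.symm zz)) (W (q, v))
        rw [metricInCoords_apply]
        have k2 : ∀ (a : TangentSpace (𝓡 4) (c.symm zz)) (a' : E4), (a : E4) = a' →
            𝓢.metric.val (c.symm zz) a (mfderiv 𝓘(ℝ, E4) (𝓡 4) c.symm zz (W (q, v))) =
              𝓢.metric.val (c.symm zz) a' (mfderiv 𝓘(ℝ, E4) (𝓡 4) c.symm zz (W (q, v))) := by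
          rintro a a' rfl; rfl
        exact k2 _ _ hT
      rw [e]; exact hβ
  · -- off the support set the push is the identity
    have hid : (P.push v) =ᶠ[𝓝 q] id := P.push_eventuallyEq_id hq
    rw [hid.mfderiv_eq, mfderiv_id]
    have hpt : P.push v q = q := P.push_eq_self_of_not_mem hq
    rw [LorentzianMetric.isFutureDirected_congr_point hpt rfl]
    exact 𝓢.timeOrientation.isFutureDirected_vectorField q

/-! ### `Cᵏ_loc` convergence of the pushed metric components -/

/-- **The pushed metric components converge in `Cᵏ_loc`**: for every point `x` of `𝓢` and every
compact `K` in the target of `chartAt E4 x`,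
`supCkENorm K k ((P.push v ∘ c_x⁻¹)^* g − (c_x⁻¹)^* g) → 0` as `v → 0`. [cite: Petersen2006, Ch. 10 §3.2] -/
theorem tendsto_supCkENorm_metricInCoords_push_sub (x : 𝓢.carrier) {K : Set E4} (hK : IsCompact K)
    (hKt : K ⊆ (chartAt E4 x).target) (k : ℕ) :
    Tendsto (fun v ↦ supCkENorm K k
      (𝓢.metricInCoords (P.push v ∘ (chartAt E4 x).symm) - 𝓢.metricInCoords (chartAt E4 x).symm))
      (𝓝 0) (𝓝 0) := by
  classical
  set c := chartAt E4 x₀ with hc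
  set c' := chartAt E4 x with hc'
  set dev : E4 → E4 → E4 →L[ℝ] E4 →L[ℝ] ℝ := fun v ↦
    𝓢.metricInCoords (P.push v ∘ c'.symm) - 𝓢.metricInCoords c'.symm with hdev
  -- the two open sets
  set O : Bool → Set E4 := fun b ↦ if b then c'.target ∩ c'.symm ⁻¹' c.source
    else c'.target ∩ c'.symm ⁻¹' P.supportSetᶜ with hO
  have hOo : ∀ b, IsOpen (O b) := by
    intro b; cases b
    · exact c'.continuousOn_symm.isOpen_inter_preimage c'.open_target
        P.isCompact_supportSet.isClosed.isOpen_compl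
    · exact c'.continuousOn_symm.isOpen_inter_preimage c'.open_target c.open_source
  have hKO : K ⊆ ⋃ b, O b := fun y hy ↦ by
    by_cases h : c'.symm y ∈ P.supportSet
    · exact mem_iUnion.2 ⟨true, hKt hy, P.supportSet_subset_source h⟩
    · exact mem_iUnion.2 ⟨false, hKt hy, h⟩
  obtain ⟨S, ε, hSO, hKS⟩ := exists_finset_closedBall_pieces_of_isCompact hK O hOo hKO
  set Pc : E4 → Set E4 := fun y ↦ K ∩ closedBall y (ε y) with hPc
  have hPcc : ∀ y, IsCompact (Pc y) := fun y ↦ hK.inter_right isClosed_closedBall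
  have hR : ∀ᶠ v in 𝓝 (0 : E4), ‖v‖ < P.R := by
    filter_upwards [Metric.ball_mem_nhds (0 : E4) P.R_pos] with v hv; simpa using hv
  -- each piece
  have hpiece : ∀ y ∈ S, Tendsto (fun v ↦ supCkENorm (Pc y) k (dev v)) (𝓝 0) (𝓝 0) := by
    intro y hy
    obtain ⟨b, hPO⟩ := hSO y hy
    cases b with
    | false =>
      -- off the support set: the deviation vanishes identically near the piece
      have hz : ∀ v, supCkENorm (Pc y) k (dev v) = 0 := by
        intro v
        have hg : ∀ y' ∈ Pc y, dev v =ᶠ[𝓝 y'] 0 := by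
          intro y' hy'
          filter_upwards [(hOo false).mem_nhds (hPO hy')] with y'' hy''
          have hy''2 : c'.symm y'' ∉ P.supportSet := hy''.2
          have hloc : P.push v ∘ c'.symm =ᶠ[𝓝 y''] c'.symm := by
            have hopen : IsOpen (c'.target ∩ c'.symm ⁻¹' P.supportSetᶜ) := hOo false
            filter_upwards [hopen.mem_nhds hy''] with w hw
            exact P.push_eq_self_of_not_mem hw.2
          show 𝓢.metricInCoords (P.push v ∘ c'.symm) y'' - 𝓢.metricInCoords c'.symm y'' = 0
          rw [𝓢.metricInCoords_congr_of_eventuallyEq hloc]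
          exact sub_self (𝓢.metricInCoords c'.symm y'')
        rw [supCkENorm_congr hg]; exact supCkENorm_zero _ _
      simp only [hz]; exact tendsto_const_nhds
    | true =>
      -- over the chart source: transport of `θ_v^* G_c − G_c` along the chart transition
      set τ : E4 → E4 := chartTransition (id : 𝓢.carrier → 𝓢.carrier) x x₀ with hτ
      set s : Set E4 := transitionDomain (id : 𝓢.carrier → 𝓢.carrier) univ x x₀ with hs
      have hso : IsOpen s := isOpen_transitionDomain isOpen_univ continuousOn_id x x₀
      have hτs : ContDiffOn ℝ ∞ τ s := contDiffOn_chartTransition contMDiffOn_id x x₀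
      have hPs : Pc y ⊆ s := fun y' hy' ↦ mem_transitionDomain.2 ⟨(hPO hy').1, mem_univ _, (hPO hy').2⟩
      have hτt : ∀ y' ∈ s, τ y' ∈ c.target := fun y' hy' ↦
        c.map_source (mem_transitionDomain.1 hy').2.2
      set K'' : Set E4 := τ '' Pc y with hK''
      have hK''c : IsCompact K'' := (hPcc y).image_of_continuousOn (hτs.continuousOn.mono hPs)
      have hK''t : K'' ⊆ c.target := by rintro _ ⟨y', hy', rfl⟩; exact hτt y' (hPs hy')
      set Gc : E4 → E4 →L[ℝ] E4 →L[ℝ] ℝ := 𝓢.metricInCoords c.symm with hGc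
      have hGc : ContDiffOn ℝ ∞ Gc c.target := 𝓢.contDiffOn_metricInCoords_chartAt_symm x₀
      set B : E4 → E4 → E4 →L[ℝ] E4 →L[ℝ] ℝ := fun v ↦ bilinPullback (P.θ v) Gc - Gc with hB
      have hlimB : Tendsto (fun v ↦ supCkENorm K'' k (B v)) (𝓝 0) (𝓝 0) :=
        tendsto_supCkENorm_bilinPullback_pointPush_sub P.χ.contDiff c.open_target hGc hK''c hK''t k
      have hBsmooth : ∀ᶠ v in 𝓝 (0 : E4), ∃ t : Set E4, IsOpen t ∧ K'' ⊆ t ∧ ContDiffOn ℝ k (B v) t := by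
        filter_upwards [hR] with v hv
        refine ⟨c.target ∩ P.θ v ⁻¹' c.target,
          (P.contDiff_θ v).continuous.continuousOn.isOpen_inter_preimage c.open_target c.open_target,
          fun w hw ↦ ⟨hK''t hw, P.θ_mem_target hv (hK''t hw)⟩, ?_⟩
        have h1 : ContDiffOn ℝ k (bilinPullback (P.θ v) Gc) (c.target ∩ P.θ v ⁻¹' c.target) :=
          ContDiffOn.bilinPullback ((P.contDiff_θ v).contDiffOn.of_le (by exact_mod_cast le_top))
            (hGc.of_le (by exact_mod_cast le_top))
            ((P.contDiff_θ v).continuous.continuousOn.isOpen_inter_preimage c.open_target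
              c.open_target) fun w hw ↦ hw.2
        exact h1.sub ((hGc.of_le (by exact_mod_cast le_top)).mono inter_subset_left)
      have hlim := tendsto_supCkENorm_bilinPullback hso
        ((hτs.of_le (by exact_mod_cast le_top)) : ContDiffOn ℝ (k + 1) τ s) (hPcc y) hPs
        (fun y' hy' ↦ mem_image_of_mem _ hy') hBsmooth hlimB
      -- germ identity on the piece, for `‖v‖ < R`
      have hgerm : ∀ᶠ v in 𝓝 (0 : E4), ∀ y' ∈ Pc y, dev v =ᶠ[𝓝 y'] bilinPullback τ (B v) := by
        filter_upwards [hR] with v hv y' hy'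
        filter_upwards [hso.mem_nhds (hPs hy')] with y'' hy''
        obtain ⟨h1, -, h3⟩ := mem_transitionDomain.1 hy''
        have hτy : τ y'' ∈ c.target := c.map_source h3
        have hθt : P.θ v (τ y'') ∈ c.target := P.θ_mem_target hv hτy
        have hτd : DifferentiableAt ℝ τ y'' := differentiableAt_chartTransition h1 mdifferentiableAt_id h3
        have hθd : DifferentiableAt ℝ (P.θ v) (τ y'') := (P.contDiff_θ v).differentiable (by simp) _
        have hθm : MDifferentiableAt 𝓘(ℝ, E4) 𝓘(ℝ, E4) (P.θ v) (τ y'') :=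
          mdifferentiableAt_iff_differentiableAt.2 hθd
        have hsymm : MDifferentiableAt 𝓘(ℝ, E4) (𝓡 4) c.symm (P.θ v (τ y'')) :=
          mdifferentiableAt_atlas_symm (chart_mem_atlas E4 x₀) hθt
        have hsymm' : MDifferentiableAt 𝓘(ℝ, E4) (𝓡 4) c.symm (τ y'') :=
          mdifferentiableAt_atlas_symm (chart_mem_atlas E4 x₀) hτy
        -- `push ∘ c'⁻¹ = (c⁻¹ ∘ θ) ∘ τ` and `c'⁻¹ = c⁻¹ ∘ τ` near `y''`
        have e0 : c'.symm =ᶠ[𝓝 y''] c.symm ∘ τ :=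
          comp_symm_eventuallyEq_symm_comp_chartTransition (F := (id : 𝓢.carrier → 𝓢.carrier))
            h1 continuousAt_id h3
        have e1 : P.push v ∘ c'.symm =ᶠ[𝓝 y''] (c.symm ∘ P.θ v) ∘ τ := by
          have hev : ∀ᶠ w in 𝓝 y'', w ∈ s := hso.mem_nhds hy''
          filter_upwards [hev] with w hw
          obtain ⟨-, -, hw3⟩ := mem_transitionDomain.1 hw
          show P.push v (c'.symm w) = c.symm (P.θ v (c (c'.symm w)))
          exact P.push_apply_of_mem hw3
        have k1 : 𝓢.metricInCoords (P.push v ∘ c'.symm) y'' =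
            bilinPullback τ (𝓢.metricInCoords (c.symm ∘ P.θ v)) y'' :=
          𝓢.metricInCoords_eq_bilinPullback_of_eventuallyEq e1 (hsymm.comp _ hθm) hτd
        have k2 : 𝓢.metricInCoords c'.symm y'' = bilinPullback τ Gc y'' :=
          𝓢.metricInCoords_eq_bilinPullback_of_eventuallyEq e0 hsymm' hτd
        have k3 : 𝓢.metricInCoords (c.symm ∘ P.θ v) (τ y'') = bilinPullback (P.θ v) Gc (τ y'') :=
          𝓢.metricInCoords_comp hsymm hθd
        show 𝓢.metricInCoords (P.push v ∘ c'.symm) y'' - 𝓢.metricInCoords c'.symm y'' =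
          bilinPullback τ (bilinPullback (P.θ v) Gc - Gc) y''
        rw [k1, k2, bilinPullback_congr_point k3, bilinPullback_sub_apply]
      refine (tendsto_congr' ?_).2 hlim
      filter_upwards [hgerm] with v hv
      exact supCkENorm_congr hv
  have hsum : Tendsto (fun v ↦ ∑ y ∈ S, supCkENorm (Pc y) k (dev v)) (𝓝 0) (𝓝 0) := by
    have h := tendsto_finsetSum S fun y hy ↦ hpiece y hy
    simpa using h
  refine tendsto_of_tendsto_of_tendsto_of_le_of_le tendsto_const_nhds hsum (fun _ ↦ zero_le)
    fun v ↦ ?_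
  exact (supCkENorm_mono hKS k _).trans (supCkENorm_biUnion_finset_le S Pc k _)

end PushData

end Spacetime

end Literature.Geometry.Lorentzian
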